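import Mathlib
import Summits.Ventures.PercRepro.TriangleCapTwoTrianglesC

/-!
# PercRepro — THE TWO-TRIANGLE CASE TWO BELOW THE DIAGONAL, PART A: far pairs around two triangles
(p3, gen 36; part 51)

Two triangles `u v w`, `a b c` (`a ∉ {u, v, w}`) of a `K₄⁻`-free graph share at most one vertex; a vertex off
`S = {u, v, w, a, b, c}` is adjacent to at most one vertex of each triangle (`at_most_one_of_triangle`, §10ax).
Hence

* `exists_nonadj_mem_of_triangle` — two vertices off a triangle have a common non-neighbour IN the triangle;
* `exists_far_edge_of_triangle` — a vertex off a triangle is far from one of its edges;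
* `far_ge_four_of_not_mem` — a vertex off `S` is far from an edge of each triangle: `far(z) ≥ 4`;
* `shared_unique_of_triangles` — the shared vertex of the two triangles, if any, is unique;
* `one_le_card_far_of_pair` — for an adjacent pair `(r, t)` with `r ∉ S` and `t ∈ S` not shared, some vertex of `S`
  is adjacent to neither; for `r, r′ ∉ S` likewise (`one_le_card_far_of_pair_off`).
Axioms: standard.
-/

namespace PercRepro

namespace TriangleCap

namespace C047

open Finset

variable {V : Type*} [Fintype V] [DecidableEq V]

/-- Two vertices off a triangle `p q s` have a common non-neighbour among `p, q, s`. -/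
theorem exists_nonadj_mem_of_triangle (D : SimpleGraph V) [DecidableRel D.Adj] (hK : K4mFree D) {p q s : V}
    (hpq : D.Adj p q) (hps : D.Adj p s) (hqs : D.Adj q s) {r y : V} (hr : ¬ (r = p ∨ r = q ∨ r = s))
    (hy : ¬ (y = p ∨ y = q ∨ y = s)) : ∃ z, (z = p ∨ z = q ∨ z = s) ∧ ¬ D.Adj r z ∧ ¬ D.Adj y z := by
  obtain ⟨h1, h2, h3⟩ := at_most_one_of_triangle D hK hpq hps hqs hr
  obtain ⟨g1, g2, g3⟩ := at_most_one_of_triangle D hK hpq hps hqs hy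
  by_cases hrp : D.Adj r p <;> by_cases hrq : D.Adj r q <;> by_cases hrs : D.Adj r s <;>
    by_cases hyp : D.Adj y p <;> by_cases hyq : D.Adj y q <;> by_cases hys : D.Adj y s
  all_goals first
    | exact ⟨p, Or.inl rfl, hrp, hyp⟩
    | exact ⟨q, Or.inr (Or.inl rfl), hrq, hyq⟩
    | exact ⟨s, Or.inr (Or.inr rfl), hrs, hys⟩
    | exact (h1 ⟨hrp.symm, hrq.symm⟩).elim
    | exact (h2 ⟨hrp.symm, hrs.symm⟩).elim
    | exact (h3 ⟨hrq.symm, hrs.symm⟩).elim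
    | exact (g1 ⟨hyp.symm, hyq.symm⟩).elim
    | exact (g2 ⟨hyp.symm, hys.symm⟩).elim
    | exact (g3 ⟨hyq.symm, hys.symm⟩).elim

/-- A vertex off a triangle is far from one of its edges. -/
theorem exists_far_edge_of_triangle (D : SimpleGraph V) [DecidableRel D.Adj] (hK : K4mFree D) {p q s : V}
    (hpq : D.Adj p q) (hps : D.Adj p s) (hqs : D.Adj q s) {r : V} (hr : ¬ (r = p ∨ r = q ∨ r = s)) :
    ∃ x y, (x = p ∨ x = q ∨ x = s) ∧ (y = p ∨ y = q ∨ y = s) ∧ D.Adj x y ∧ ¬ D.Adj x r ∧ ¬ D.Adj y r := by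
  obtain ⟨h1, h2, h3⟩ := at_most_one_of_triangle D hK hpq hps hqs hr
  by_cases hrp : D.Adj p r <;> by_cases hrq : D.Adj q r <;> by_cases hrs : D.Adj s r
  all_goals first
    | exact ⟨p, q, Or.inl rfl, Or.inr (Or.inl rfl), hpq, hrp, hrq⟩
    | exact ⟨p, s, Or.inl rfl, Or.inr (Or.inr rfl), hps, hrp, hrs⟩
    | exact ⟨q, s, Or.inr (Or.inl rfl), Or.inr (Or.inr rfl), hqs, hrq, hrs⟩
    | exact (h1 ⟨hrp, hrq⟩).elim
    | exact (h2 ⟨hrp, hrs⟩).elim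
    | exact (h3 ⟨hrq, hrs⟩).elim

omit [Fintype V] [DecidableEq V] in
/-- The third vertex of a triangle on two of its vertices. -/
theorem third_vertex' (D : SimpleGraph V) [DecidableRel D.Adj] {p q s : V}
    (hpq : D.Adj p q) (hps : D.Adj p s) (hqs : D.Adj q s) {x y : V}
    (hx : x = p ∨ x = q ∨ x = s) (hy : y = p ∨ y = q ∨ y = s) (hxy : x ≠ y) :
    ∃ t, (t = p ∨ t = q ∨ t = s) ∧ t ≠ x ∧ t ≠ y ∧ D.Adj x t ∧ D.Adj y t := by
  rcases hx with rfl | rfl | rfl <;> rcases hy with rfl | rfl | rfl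
  all_goals first
    | exact (hxy rfl).elim
    | exact ⟨_, Or.inr (Or.inr rfl), hps.ne.symm, hqs.ne.symm, hps, hqs⟩
    | exact ⟨_, Or.inr (Or.inr rfl), hqs.ne.symm, hps.ne.symm, hqs, hps⟩
    | exact ⟨_, Or.inr (Or.inl rfl), hpq.ne.symm, hqs.ne, hpq, hqs.symm⟩
    | exact ⟨_, Or.inr (Or.inl rfl), hqs.ne, hpq.ne.symm, hqs.symm, hpq⟩
    | exact ⟨_, Or.inl rfl, hpq.ne, hps.ne, hpq.symm, hps.symm⟩
    | exact ⟨_, Or.inl rfl, hps.ne, hpq.ne, hps.symm, hpq.symm⟩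

/-- Two triangles `u v w`, `a b c` of a `K₄⁻`-free graph with `a ∉ {u, v, w}` share no edge. -/
theorem not_shared_edge (D : SimpleGraph V) [DecidableRel D.Adj] (hK : K4mFree D) {u v w a b c : V}
    (huv : D.Adj u v) (huw : D.Adj u w) (hvw : D.Adj v w) (hab : D.Adj a b) (hac : D.Adj a c) (hbc : D.Adj b c)
    (ha : ¬ (a = u ∨ a = v ∨ a = w)) {x y : V} (hxy : x ≠ y)
    (hx1 : x = u ∨ x = v ∨ x = w) (hy1 : y = u ∨ y = v ∨ y = w)
    (hx2 : x = a ∨ x = b ∨ x = c) (hy2 : y = a ∨ y = b ∨ y = c) : False := by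
  obtain ⟨t, ht1, htx, hty, hxt, hyt⟩ := third_vertex' D huv huw hvw hx1 hy1 hxy
  by_cases ht2 : t = a ∨ t = b ∨ t = c
  · -- `{x, y, t}` is all of `{a, b, c}`, so `a ∈ {u, v, w}`
    have hsub : ({x, y, t} : Finset V) ⊆ {a, b, c} := by
      intro z hz
      simp only [mem_insert, mem_singleton] at hz ⊢
      rcases hz with rfl | rfl | rfl
      · exact hx2
      · exact hy2
      · exact ht2
    have hcard : ({x, y, t} : Finset V).card = 3 := by
      rw [card_insert_of_notMem, card_pair hty.symm]
      rw [mem_insert, mem_singleton]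
      rintro (h | h)
      · exact hxy h
      · exact htx h.symm
    have hcard2 : ({a, b, c} : Finset V).card ≤ 3 := card_le_three
    have heq : ({x, y, t} : Finset V) = {a, b, c} := eq_of_subset_of_card_le hsub (by omega)
    have hamem : a ∈ ({x, y, t} : Finset V) := by rw [heq]; exact mem_insert_self _ _
    simp only [mem_insert, mem_singleton] at hamem
    apply ha
    rcases hamem with rfl | rfl | rfl
    · exact hx1
    · exact hy1
    · exact ht1
  · -- `t` is off `a b c` and adjacent to the two distinct vertices `x, y` of it
    have h := at_most_one_of_triangle D hK hab hac hbc ht2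
    rcases hx2 with rfl | rfl | rfl <;> rcases hy2 with rfl | rfl | rfl
    all_goals first
      | exact (hxy rfl).elim
      | exact h.1 ⟨hxt, hyt⟩
      | exact h.1 ⟨hyt, hxt⟩
      | exact h.2.1 ⟨hxt, hyt⟩
      | exact h.2.1 ⟨hyt, hxt⟩
      | exact h.2.2 ⟨hxt, hyt⟩
      | exact h.2.2 ⟨hyt, hxt⟩

/-- A vertex off `S = {u, v, w, a, b, c}` is far from an edge of each triangle: `far(z) ≥ 4`. -/
theorem far_ge_four_of_not_mem (D : SimpleGraph V) [DecidableRel D.Adj] (hK : K4mFree D) {u v w a b c : V}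
    (huv : D.Adj u v) (huw : D.Adj u w) (hvw : D.Adj v w) (hab : D.Adj a b) (hac : D.Adj a c) (hbc : D.Adj b c)
    (ha : ¬ (a = u ∨ a = v ∨ a = w)) {z : V} (hz : ¬ (z = u ∨ z = v ∨ z = w ∨ z = a ∨ z = b ∨ z = c)) :
    4 ≤ far D z := by
  have hz1 : ¬ (z = u ∨ z = v ∨ z = w) := fun h => hz (by tauto)
  have hz2 : ¬ (z = a ∨ z = b ∨ z = c) := fun h => hz (by tauto)
  obtain ⟨x₁, y₁, hx₁, hy₁, hxy₁, hzx₁, hzy₁⟩ := exists_far_edge_of_triangle D hK huv huw hvw hz1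
  obtain ⟨x₂, y₂, hx₂, hy₂, hxy₂, hzx₂, hzy₂⟩ := exists_far_edge_of_triangle D hK hab hac hbc hz2
  unfold far
  have hsub : ({(x₁, y₁), (y₁, x₁), (x₂, y₂), (y₂, x₂)} : Finset (V × V)) ⊆
      (adjPairsAll D).filter (fun p => ¬ D.Adj p.1 z ∧ ¬ D.Adj p.2 z) := by
    intro p hp
    simp only [mem_insert, mem_singleton] at hp
    rw [mem_filter, mem_adjPairsAll]
    rcases hp with rfl | rfl | rfl | rfl
    · exact ⟨hxy₁, hzx₁, hzy₁⟩
    · exact ⟨hxy₁.symm, hzy₁, hzx₁⟩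
    · exact ⟨hxy₂, hzx₂, hzy₂⟩
    · exact ⟨hxy₂.symm, hzy₂, hzx₂⟩
  have hcard : ({(x₁, y₁), (y₁, x₁), (x₂, y₂), (y₂, x₂)} : Finset (V × V)).card = 4 := by
    -- the two edges are distinct: a common edge would be shared by the triangles
    have hne : ∀ (p : V) (q : V), (p = x₁ ∧ q = y₁) ∨ (p = y₁ ∧ q = x₁) → (p = x₂ ∧ q = y₂) ∨ (p = y₂ ∧ q = x₂) → False := by
      rintro p q (⟨rfl, rfl⟩ | ⟨rfl, rfl⟩) (⟨h1, h2⟩ | ⟨h1, h2⟩)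
      · exact not_shared_edge D hK huv huw hvw hab hac hbc ha hxy₁.ne hx₁ hy₁ (h1 ▸ hx₂) (h2 ▸ hy₂)
      · exact not_shared_edge D hK huv huw hvw hab hac hbc ha hxy₁.ne hx₁ hy₁ (h1 ▸ hy₂) (h2 ▸ hx₂)
      · exact not_shared_edge D hK huv huw hvw hab hac hbc ha hxy₁.ne.symm hy₁ hx₁ (h1 ▸ hx₂) (h2 ▸ hy₂)
      · exact not_shared_edge D hK huv huw hvw hab hac hbc ha hxy₁.ne.symm hy₁ hx₁ (h1 ▸ hy₂) (h2 ▸ hx₂)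
    rw [card_insert_of_notMem, card_insert_of_notMem, card_pair]
    · intro h; exact hxy₂.ne (Prod.mk.inj h).1
    · rw [mem_insert, mem_singleton]
      rintro (h | h)
      · exact hne y₁ x₁ (Or.inr ⟨rfl, rfl⟩) (Or.inl ⟨(Prod.mk.inj h).1, (Prod.mk.inj h).2⟩)
      · exact hne y₁ x₁ (Or.inr ⟨rfl, rfl⟩) (Or.inr ⟨(Prod.mk.inj h).1, (Prod.mk.inj h).2⟩)
    · rw [mem_insert, mem_insert, mem_singleton]
      rintro (h | h | h)
      · exact hxy₁.ne (Prod.mk.inj h).1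
      · exact hne x₁ y₁ (Or.inl ⟨rfl, rfl⟩) (Or.inl ⟨(Prod.mk.inj h).1, (Prod.mk.inj h).2⟩)
      · exact hne x₁ y₁ (Or.inl ⟨rfl, rfl⟩) (Or.inr ⟨(Prod.mk.inj h).1, (Prod.mk.inj h).2⟩)
  have := card_le_card hsub
  rw [hcard] at this
  exact this

end C047

end TriangleCap

end PercRepro
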